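import Mathlib
import Literature.Computability.AlgebraicComplexity.SymmetricArithCircuit
import Literature.Computability.AlgebraicComplexity.SymmetricPowerChainCircuit
import Literature.Computability.AlgebraicComplexity.DawarWilsenach2025
import HarnessLib

/-!
# The symmetric power chain is rigid: orbit size `≤ max |X| 1`

Topic `Computability/AlgebraicComplexity`, namespace
`Literature.Computability.AlgebraicComplexity.PowerChainCircuit`.

Continuation of `SymmetricPowerChainCircuit.lean` (the `Γ`-symmetric circuit
`zero, inp x → sum → (cp 0, sq 0) → ⋯ → (cp (m-1), sq (m-1))` computing `(Σ_x x)^(2^m)`), over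
`DawarWilsenach2025.lean` (`LabelledArithCircuit.autOrbit`, `orbitSize` = the orbit of a gate over
ALL automorphisms extending group elements and `ORB(C)`, Dawar–Wilsenach §3.3).

* `apply_eq_smul` — **rigidity** in the strong form: an automorphism `π` extending `γ`
  (Def. 3.6) IS the action of `γ` on the gates.  Proof: `π` fixes the constant gate `zero`
  (constants are fixed), hence `sum` (the only gate with the child `zero`), and inductively on
  the level `k`: fixing level `k` it fixes `cp k` (the only `+` gate with children `{level k}`)
  and then `sq k` (the only gate with the child `cp k`); inputs go to inputs as `γ` prescribes.
  `isRigid` is Dawar–Wilsenach rigidity (Def. 3.6).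
* `ncard_autOrbit_le`, `orbitSize_le` — hence the orbit of an input is a set of inputs and every
  other orbit is a singleton: `ORB ≤ max |X| 1`, although the circuit has `2m + 2` further
  gates and computes a polynomial of degree `2^m`.
* `LabelledArithCircuit.exists_symmetric_powerChain` — the packaged existence statement
  (symmetric, value `(Σ_x x)^(2^m)`, orbit size `≤ max |X| 1`, exactly `|X| + 2m + 2` gates).

Everything is proved; folklore.  Consumer: crux `MonotoneRestorationQP` of route
`Summits/ValiantsHypothesis/…/Theses/MonotoneRestoration.lean` (line Sketch v10, the negative
lemma "orbit compression is false without `VP`").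
-/

noncomputable section

namespace Literature.Computability.AlgebraicComplexity

open MvPolynomial

universe u v w

namespace PowerChainCircuit

open Gate

variable {X : Type v} {m : ℕ}

/-! ### Rigidity: every automorphism is the action -/

section Rigid

variable {K : Type u} [Zero K] {Γ : Type w} [Group Γ] [Fintype X] [DecidableEq X] [MulAction Γ X]
  {γ : Γ} {π : Equiv.Perm (Gate X m)}
  (h : (circuit K Γ X m).IsAutomorphismExtending γ π)
include h

/-- An automorphism fixes the constant gate. [folklore] -/
theorem apply_zero : π zero = zero := h.apply_eq_self_of_label_const (c := (0 : K)) rfl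

/-- An automorphism extending `γ` moves the input `x` to the input `γ • x`. [folklore] -/
theorem apply_inp (x : X) : π (inp x) = inp (γ • x) :=
  (circuit K Γ X m).eq_of_label_eq (π (inp x)) (inp (γ • x))
    (by rw [h.label_apply]; simp [circuit_label, label]) (by rw [h.label_apply]; rfl)

/-- An automorphism fixes the sum gate (the only gate with the child `zero`). [folklore] -/
theorem apply_sum : π sum = sum := by
  apply eq_sum_of_zero_mem_children
  rw [← circuit_children (K := K) (Γ := Γ), h.children_apply, Finset.mem_map]
  exact ⟨zero, by simp [circuit_children, children], apply_zero h⟩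

/-- An automorphism fixing level `k` fixes its copy. [folklore] -/
theorem apply_cp_of_apply_lvl (k : Fin m) (hk : π (lvl k.castSucc) = lvl k.castSucc) :
    π (cp k) = cp k := by
  refine eq_cp_of_children_eq K ?_ ?_
  · rw [← circuit_children (K := K) (Γ := Γ), h.children_apply, circuit_children, children,
      Finset.map_singleton, Equiv.toEmbedding_apply, hk]
  · rw [← circuit_label (Γ := Γ), h.label_apply]; rfl

/-- An automorphism fixing the copy of level `k` fixes level `k + 1` (the only gate with the child
`cp k`). [folklore] -/
theorem apply_sq_of_apply_cp (k : Fin m) (hk : π (cp k) = cp k) : π (sq k) = sq k := by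
  apply eq_sq_of_cp_mem_children
  rw [← circuit_children (K := K) (Γ := Γ), h.children_apply, Finset.mem_map]
  exact ⟨cp k, by simp [circuit_children, children], hk⟩

/-- An automorphism fixes every level. [folklore] -/
theorem apply_lvl (k : Fin (m + 1)) : π (lvl k) = lvl k := by
  induction k using Fin.induction with
  | zero => rw [lvl_zero]; exact apply_sum h
  | succ k ih => rw [lvl_succ]; exact apply_sq_of_apply_cp h k (apply_cp_of_apply_lvl h k ih)

/-- An automorphism fixes every copy gate. [folklore] -/
theorem apply_cp (k : Fin m) : π (cp k) = cp k := apply_cp_of_apply_lvl h k (apply_lvl h _)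

/-- An automorphism fixes every squaring gate. [folklore] -/
theorem apply_sq (k : Fin m) : π (sq k) = sq k := by rw [← lvl_succ]; exact apply_lvl h _

/-- **Rigidity of the power chain**: an automorphism extending `γ` is the action of `γ`.
[folklore] -/
theorem apply_eq_smul (g : Gate X m) : π g = γ • g := by
  cases g with
  | inp x => exact apply_inp h x
  | zero => exact apply_zero h
  | sum => exact apply_sum h
  | cp k => exact apply_cp h k
  | sq k => exact apply_sq h k

omit h in
/-- The power chain is rigid (Dawar–Wilsenach Def. 3.6). [folklore] -/
theorem isRigid : (circuit K Γ X m).IsRigid Γ := by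
  intro γ π π' hπ hπ'
  ext g
  rw [apply_eq_smul hπ, apply_eq_smul hπ']

end Rigid

/-! ### Orbits -/

section Orbit

variable {K : Type u} [Zero K] {Γ : Type w} [Group Γ] [Fintype X] [DecidableEq X] [MulAction Γ X]

/-- The orbit of a gate over all automorphisms is contained in its orbit under the action.
[folklore] -/
theorem autOrbit_subset_range (g : Gate X m) :
    (circuit K Γ X m).autOrbit Γ g ⊆ Set.range fun γ : Γ => γ • g := by
  rintro _ ⟨γ, π, hπ, rfl⟩
  exact ⟨γ, (apply_eq_smul hπ g).symm⟩

/-- Every orbit of the power chain has at most `max |X| 1` gates: the orbit of an input is a set of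
inputs, every other gate is fixed by all automorphisms. [folklore] -/
theorem ncard_autOrbit_le (g : Gate X m) :
    ((circuit K Γ X m).autOrbit Γ g).ncard ≤ max (Fintype.card X) 1 := by
  have hsub := autOrbit_subset_range (K := K) (Γ := Γ) g
  cases g with
  | inp x =>
    refine le_trans ?_ (le_max_left _ _)
    have h1 : (Set.range fun γ : Γ => γ • (inp x : Gate X m)) ⊆ inp '' Set.univ := by
      rintro _ ⟨γ, rfl⟩; exact ⟨γ • x, Set.mem_univ _, rfl⟩
    calc ((circuit K Γ X m).autOrbit Γ (inp x)).ncard ≤ (inp '' (Set.univ : Set X)).ncard :=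
          Set.ncard_le_ncard (hsub.trans h1) (Set.toFinite _)
      _ ≤ (Set.univ : Set X).ncard := Set.ncard_image_le (Set.toFinite _)
      _ = Fintype.card X := by rw [Set.ncard_univ, Nat.card_eq_fintype_card]
  | _ =>
    refine le_trans ?_ (le_max_right _ _)
    refine (Set.ncard_le_ncard hsub (Set.toFinite _)).trans ?_
    rw [Set.ncard_le_one_iff (Set.toFinite _)]
    rintro _ _ ⟨γ, rfl⟩ ⟨γ', rfl⟩
    simp

/-- **The power chain has orbit size `≤ max |X| 1`** (Dawar–Wilsenach's `ORB`, over all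
automorphisms). [folklore] -/
theorem orbitSize_le : (circuit K Γ X m).orbitSize Γ ≤ max (Fintype.card X) 1 :=
  Finset.sup_le fun g _ => ncard_autOrbit_le g

end Orbit

end PowerChainCircuit

/-- **Symmetric power chains** (packaged): for a finite `Γ`-set of variables `X` and `m : ℕ` there
is a `Γ`-symmetric labelled arithmetic circuit over any commutative semiring `K` computing
`(Σ_x x)^(2^m)` at its output, with every orbit (over all automorphisms, Dawar–Wilsenach §3.3) of
size `≤ max |X| 1`, on exactly `|X| + 2m + 2` gates. [folklore] -/
theorem LabelledArithCircuit.exists_symmetric_powerChain (K : Type u) [CommSemiring K]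
    (Γ : Type w) [Group Γ] (X : Type v) [Fintype X] [MulAction Γ X] (m : ℕ) :
    ∃ (G : Type v) (_ : Fintype G) (C : LabelledArithCircuit K X Unit G),
      C.IsSymmetric Γ ∧ C.eval (C.output ()) = (∑ x : X, MvPolynomial.X x) ^ (2 ^ m) ∧
      C.orbitSize Γ ≤ max (Fintype.card X) 1 ∧ Fintype.card G = Fintype.card X + 2 * m + 2 := by
  classical
  exact ⟨PowerChainCircuit.Gate X m, inferInstance,
    (PowerChainCircuit.circuit K Γ X m).toLabelledArithCircuit,
    (PowerChainCircuit.circuit K Γ X m).isSymmetric, PowerChainCircuit.eval_output,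
    PowerChainCircuit.orbitSize_le, PowerChainCircuit.Gate.card_gate⟩

end Literature.Computability.AlgebraicComplexity

end
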